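import Literature.NumberTheory.EllipticCurves.ModularSymbolsManinGeneration
import HarnessLib

/-!
# Manin's relations: which functions on `SL₂(ℤ)` come from modular symbols

Completion of Manin's theorem for the abstract modular symbols of `ModularSymbolsCoefficients`
(`ModularSymbolsManinGeneration` proved the generation = uniqueness half).  For a function
`f : SL₂(ℤ) → V` consider the **Manin relations**

  (R2) `f(gσ) = −f(g)`,   (R3) `f(g) = f(gT) + f(gL)`,
  `σ = (0 −1; 1 0)`, `T = (1 1; 0 1)`, `L = (1 0; 1 1)`

(the edge `(g·∞, g·0)` reversed is `(gσ·∞, gσ·0)`; the edges of `g, gT, gL` bound the Farey triangle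
`(g·∞, g·0, g·1)`).  They are satisfied by `f(g) = φ(g·∞, g·0)` for every additive `φ`
(`isManinFn_maninFn`), and conversely (**Manin 1972, Thm. 1.9**, in functional form):
**every `f` satisfying (R2), (R3) is `g ↦ φ(g·∞, g·0)` for a unique additive `φ`**
(`exists_modSym_of_isManinFn`, `existsUnique_modSym_of_isManinFn`); `Γ`-equivariant `f` give
`Γ`-invariant symbols (`exists_Symb_of_isManinFn`).  Equivalently, `Δ₀ = Div⁰(ℙ¹(ℚ))` is presented as a
`ℤ[SL₂(ℤ)]`-module by the unimodular symbols with the relations (R2), (R3) — Manin's `(1 + σ)`,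
`(1 + τ + τ²)` presentation in the form used by modular-symbol algorithms (Cremona) and by the lifting
theorems of Pollack–Stevens and Greenberg.

Proof of the converse: a potential `F : ℙ¹(ℚ) → V`, `F(∞) = 0`, `F(b/d) = F(a/c) + f(a b; c d)` along
the CANONICAL unimodular predecessor `a/c` of `b/d` (`ad − bc = 1`, `0 ≤ c < d`; well-founded recursion
on the denominator), so that `φ_F(x, y) = F(y) − F(x)` is additive for free; then
`F(g·0) − F(g·∞) = f(g)` for ALL `g` by strong induction on `|c| + |d|`, using `g ∼ −g`, the swap
`g ∼ gσ` (R2) and the triangle (R3) to move every edge to a canonical one.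

Brick B3e-M2 of the bottom-up plan recorded with the named fact
`greenbergStevens_kitagawa_twoVariable_interpolation_allBranches`.  Everything is proved; no named facts.

## References

* Ju. I. Manin, *Parabolic points and zeta functions of modular curves*, Izv. 36 (1972), Thm. 1.9.
  [Manin1972]
* J. E. Cremona, *Algorithms for modular elliptic curves* (1997), §2.1–2.2. [folklore]
* R. Pollack, G. Stevens, Ann. Sci. ÉNS 44 (2011), §2.2. [PollackStevens2011]
-/

noncomputable section

open scoped MatrixGroups
open Matrix

namespace Literature.NumberTheory.EllipticCurves

namespace P1Q

/-! ### The matrices `σ, T, L` and the cusps `[a : c]` -/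

/-- `σ = (0 −1; 1 0)`. [folklore] -/
def σM : SL(2, ℤ) := sl2 0 (-1) 1 0 (by norm_num)

/-- `T = (1 1; 0 1)`. [folklore] -/
def TM : SL(2, ℤ) := sl2 1 1 0 1 (by norm_num)

/-- `L = (1 0; 1 1)`. [folklore] -/
def LM : SL(2, ℤ) := sl2 1 0 1 1 (by norm_num)

/-- The cusp `[a : c]`: `∞` if `c = 0`, else `a/c`. [folklore] -/
def cuspOf (a c : ℤ) : P1Q := if c = 0 then infty else ofRat ((a : ℚ) / (c : ℚ))

/-- `[a : 0] = ∞`. [folklore] -/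
@[simp] theorem cuspOf_zero (a : ℤ) : cuspOf a 0 = infty := by simp [cuspOf]

/-- `[a : c] = a/c` for `c ≠ 0`. [folklore] -/
theorem cuspOf_of_ne_zero (a : ℤ) {c : ℤ} (hc : c ≠ 0) : cuspOf a c = ofRat ((a : ℚ) / (c : ℚ)) := by simp [cuspOf, hc]

/-- `[−a : −c] = [a : c]`. [folklore] -/
theorem cuspOf_neg (a c : ℤ) : cuspOf (-a) (-c) = cuspOf a c := by
  by_cases hc : c = 0
  · simp [cuspOf, hc]
  · rw [cuspOf_of_ne_zero _ hc, cuspOf_of_ne_zero _ (neg_ne_zero.mpr hc)]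
    push_cast
    rw [neg_div_neg_eq]

/-- `det g ≠ 0` for `g ∈ SL₂(ℤ)`. [folklore] -/
theorem det_coe_sl_ne_zero (g : SL(2, ℤ)) : (g : Matrix (Fin 2) (Fin 2) ℤ).det ≠ 0 := by rw [g.2]; exact one_ne_zero

/-- **`g·∞ = [a : c]`** for `g = (a b; c d) ∈ SL₂(ℤ)`. [folklore] -/
theorem act_sl_infty (g : SL(2, ℤ)) : act (g : Matrix (Fin 2) (Fin 2) ℤ) infty = cuspOf (g 0 0) (g 1 0) := by
  obtain ⟨h, he⟩ := act_infty (det_coe_sl_ne_zero g)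
  rw [he]
  by_cases hc : g 1 0 = 0
  · rw [cuspOf, if_pos hc]
    exact mk_eq_infty h (by simp [hc])
  · rw [cuspOf_of_ne_zero _ hc, mk_eq_ofRat h (by simp; exact_mod_cast hc)]
    rfl

/-- **`g·0 = [b : d]`** for `g = (a b; c d) ∈ SL₂(ℤ)`. [folklore] -/
theorem act_sl_zero (g : SL(2, ℤ)) : act (g : Matrix (Fin 2) (Fin 2) ℤ) (ofRat 0) = cuspOf (g 0 1) (g 1 1) := by
  obtain ⟨h, he⟩ := act_ofRat_zero (det_coe_sl_ne_zero g)
  rw [he]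
  by_cases hd : g 1 1 = 0
  · rw [cuspOf, if_pos hd]
    exact mk_eq_infty h (by simp [hd])
  · rw [cuspOf_of_ne_zero _ hd, mk_eq_ofRat h (by simp; exact_mod_cast hd)]
    rfl

/-- `−M` acts like `M`. [folklore] -/
theorem act_neg {M : Matrix (Fin 2) (Fin 2) ℤ} (hM : M.det ≠ 0) (x : P1Q) : act (-M) x = act M x := by
  have hneg : (-M).det ≠ 0 := by
    rw [show -M = (-1 : Matrix (Fin 2) (Fin 2) ℤ) * M by simp, Matrix.det_mul, Matrix.det_neg, Matrix.det_one]
    simpa using hM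
  induction x using Projectivization.ind with
  | h v hv =>
    rw [act_mk hneg, act_mk hM, Projectivization.mk_eq_mk_iff']
    refine ⟨-1, ?_⟩
    simp [ratMat, Matrix.map_neg, Matrix.neg_mulVec]

/-- Entries of `σ, T, L` products: `gσ = (b, −a; d, −c)`. [folklore] -/
theorem coe_mul_σM (g : SL(2, ℤ)) :
    ((g * σM : SL(2, ℤ)) : Matrix (Fin 2) (Fin 2) ℤ) = !![g 0 1, -(g 0 0); g 1 1, -(g 1 0)] := by
  rw [Matrix.SpecialLinearGroup.coe_mul, σM, coe_sl2, mat2]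
  ext i j; fin_cases i <;> fin_cases j <;> simp [Matrix.mul_apply, Fin.sum_univ_two]

/-- `gT = (a, a + b; c, c + d)`. [folklore] -/
theorem coe_mul_TM (g : SL(2, ℤ)) :
    ((g * TM : SL(2, ℤ)) : Matrix (Fin 2) (Fin 2) ℤ) = !![g 0 0, g 0 0 + g 0 1; g 1 0, g 1 0 + g 1 1] := by
  rw [Matrix.SpecialLinearGroup.coe_mul, TM, coe_sl2, mat2]
  ext i j; fin_cases i <;> fin_cases j <;> simp [Matrix.mul_apply, Fin.sum_univ_two]

/-- `gL = (a + b, b; c + d, d)`. [folklore] -/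
theorem coe_mul_LM (g : SL(2, ℤ)) :
    ((g * LM : SL(2, ℤ)) : Matrix (Fin 2) (Fin 2) ℤ) = !![g 0 0 + g 0 1, g 0 1; g 1 0 + g 1 1, g 1 1] := by
  rw [Matrix.SpecialLinearGroup.coe_mul, LM, coe_sl2, mat2]
  ext i j; fin_cases i <;> fin_cases j <;> simp [Matrix.mul_apply, Fin.sum_univ_two]

/-- Entries of `gσ`. [folklore] -/
theorem mul_σM_entries (g : SL(2, ℤ)) :
    (g * σM : SL(2, ℤ)) 0 0 = g 0 1 ∧ (g * σM : SL(2, ℤ)) 0 1 = -(g 0 0) ∧ (g * σM : SL(2, ℤ)) 1 0 = g 1 1 ∧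
      (g * σM : SL(2, ℤ)) 1 1 = -(g 1 0) := by
  have h := coe_mul_σM g
  refine ⟨?_, ?_, ?_, ?_⟩ <;>
  · conv_lhs => rw [show ((g * σM : SL(2, ℤ)) : Matrix (Fin 2) (Fin 2) ℤ) = _ from h]
    rfl

/-- Entries of `gT`. [folklore] -/
theorem mul_TM_entries (g : SL(2, ℤ)) :
    (g * TM : SL(2, ℤ)) 0 0 = g 0 0 ∧ (g * TM : SL(2, ℤ)) 0 1 = g 0 0 + g 0 1 ∧ (g * TM : SL(2, ℤ)) 1 0 = g 1 0 ∧
      (g * TM : SL(2, ℤ)) 1 1 = g 1 0 + g 1 1 := by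
  have h := coe_mul_TM g
  refine ⟨?_, ?_, ?_, ?_⟩ <;>
  · conv_lhs => rw [show ((g * TM : SL(2, ℤ)) : Matrix (Fin 2) (Fin 2) ℤ) = _ from h]
    rfl

/-- Entries of `gL`. [folklore] -/
theorem mul_LM_entries (g : SL(2, ℤ)) :
    (g * LM : SL(2, ℤ)) 0 0 = g 0 0 + g 0 1 ∧ (g * LM : SL(2, ℤ)) 0 1 = g 0 1 ∧ (g * LM : SL(2, ℤ)) 1 0 = g 1 0 + g 1 1 ∧
      (g * LM : SL(2, ℤ)) 1 1 = g 1 1 := by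
  have h := coe_mul_LM g
  refine ⟨?_, ?_, ?_, ?_⟩ <;>
  · conv_lhs => rw [show ((g * LM : SL(2, ℤ)) : Matrix (Fin 2) (Fin 2) ℤ) = _ from h]
    rfl

/-- `σ² = −1`. [folklore] -/
theorem σM_mul_σM : σM * σM = -1 := by
  refine Subtype.ext ?_
  rw [Matrix.SpecialLinearGroup.coe_mul, σM, coe_sl2, mat2]
  ext i j; fin_cases i <;> fin_cases j <;> simp [Matrix.mul_apply, Fin.sum_univ_two]

/-- The endpoints of the edges of `gσ, gT, gL`. [folklore] -/
theorem act_mul_σM_infty (g : SL(2, ℤ)) :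
    act ((g * σM : SL(2, ℤ)) : Matrix (Fin 2) (Fin 2) ℤ) infty = act (g : Matrix (Fin 2) (Fin 2) ℤ) (ofRat 0) := by
  rw [act_sl_infty, act_sl_zero, (mul_σM_entries g).1, (mul_σM_entries g).2.2.1]

/-- `gσ·0 = g·∞`. [folklore] -/
theorem act_mul_σM_zero (g : SL(2, ℤ)) :
    act ((g * σM : SL(2, ℤ)) : Matrix (Fin 2) (Fin 2) ℤ) (ofRat 0) = act (g : Matrix (Fin 2) (Fin 2) ℤ) infty := by
  rw [act_sl_infty, act_sl_zero, (mul_σM_entries g).2.1, (mul_σM_entries g).2.2.2, cuspOf_neg]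

/-- `gT·∞ = g·∞`. [folklore] -/
theorem act_mul_TM_infty (g : SL(2, ℤ)) :
    act ((g * TM : SL(2, ℤ)) : Matrix (Fin 2) (Fin 2) ℤ) infty = act (g : Matrix (Fin 2) (Fin 2) ℤ) infty := by
  rw [act_sl_infty, act_sl_infty, (mul_TM_entries g).1, (mul_TM_entries g).2.2.1]

/-- `gL·0 = g·0`. [folklore] -/
theorem act_mul_LM_zero (g : SL(2, ℤ)) :
    act ((g * LM : SL(2, ℤ)) : Matrix (Fin 2) (Fin 2) ℤ) (ofRat 0) = act (g : Matrix (Fin 2) (Fin 2) ℤ) (ofRat 0) := by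
  rw [act_sl_zero, act_sl_zero, (mul_LM_entries g).2.1, (mul_LM_entries g).2.2.2]

/-- `gT·0 = gL·∞` (`= g·1`). [folklore] -/
theorem act_mul_TM_zero (g : SL(2, ℤ)) :
    act ((g * TM : SL(2, ℤ)) : Matrix (Fin 2) (Fin 2) ℤ) (ofRat 0) = act ((g * LM : SL(2, ℤ)) : Matrix (Fin 2) (Fin 2) ℤ) infty := by
  rw [act_sl_zero, act_sl_infty, (mul_TM_entries g).2.1, (mul_TM_entries g).2.2.2, (mul_LM_entries g).1,
    (mul_LM_entries g).2.2.1]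

end P1Q

/-! ### Manin functions -/

section ManinFn

variable {R V : Type*} [CommRing R] [AddCommGroup V] [Module R V]

open P1Q

/-- The function on `SL₂(ℤ)` of a function of pairs of cusps: `f_φ(g) = φ(g·∞, g·0)`. [cite: Manin1972, §1.6] -/
def maninFn (φ : P1Q → P1Q → V) (g : SL(2, ℤ)) : V :=
  φ (act (g : Matrix (Fin 2) (Fin 2) ℤ) infty) (act (g : Matrix (Fin 2) (Fin 2) ℤ) (ofRat 0))

omit [AddCommGroup V] in
/-- Unfolding `maninFn`. [folklore] -/
theorem maninFn_apply (φ : P1Q → P1Q → V) (g : SL(2, ℤ)) :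
    maninFn φ g = φ (act (g : Matrix (Fin 2) (Fin 2) ℤ) infty) (act (g : Matrix (Fin 2) (Fin 2) ℤ) (ofRat 0)) := rfl

/-- **The Manin relations** (R2) `f(gσ) = −f(g)` and (R3) `f(g) = f(gT) + f(gL)`. [cite: Manin1972, Thm. 1.9] -/
def IsManinFn (f : SL(2, ℤ) → V) : Prop :=
  (∀ g : SL(2, ℤ), f (g * σM) = -f g) ∧ ∀ g : SL(2, ℤ), f g = f (g * TM) + f (g * LM)

/-- **Necessity**: the function of an additive `φ` satisfies the Manin relations. [cite: Manin1972, §1.6] -/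
theorem isManinFn_maninFn {φ : P1Q → P1Q → V} (hφ : φ ∈ modSym R V) : IsManinFn (maninFn φ) := by
  refine ⟨fun g => ?_, fun g => ?_⟩
  · rw [maninFn_apply, maninFn_apply, act_mul_σM_infty, act_mul_σM_zero, modSym_swap hφ]
  · rw [maninFn_apply, maninFn_apply, maninFn_apply, act_mul_TM_infty, act_mul_TM_zero, act_mul_LM_zero,
      (mem_modSym_iff (R := R)).mp hφ]

end ManinFn

/-! ### The canonical unimodular predecessor and the potential `F` -/

section Potential

open P1Q

variable {V : Type*} [AddCommGroup V]

/-- **Existence of the canonical predecessor**: for `b` coprime to `d ≥ 1` there are `a` and `0 ≤ c < d`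
with `ad − bc = 1`. [folklore] -/
theorem exists_pred (b : ℤ) {d : ℕ} (hd : 1 ≤ d) (h : IsCoprime b (d : ℤ)) :
    ∃ ac : ℤ × ℕ, ac.2 < d ∧ ac.1 * d - b * ac.2 = 1 := by
  obtain ⟨u, v, huv⟩ := h
  have hd0 : (0 : ℤ) < d := by exact_mod_cast (by omega : 0 < d)
  set c : ℤ := (-u) % d with hc
  have hc0 : 0 ≤ c := Int.emod_nonneg _ hd0.ne'
  have hcd : c < d := Int.emod_lt_of_pos _ hd0
  have hdvd : (d : ℤ) ∣ 1 + b * c := by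
    have h1 : 1 + b * c = v * d - b * (d * ((-u) / d)) := by
      have := Int.emod_add_mul_ediv (-u) d
      rw [hc]
      linear_combination -huv + b * this
    rw [h1]
    exact dvd_sub (dvd_mul_left _ _) (dvd_mul_of_dvd_right (dvd_mul_right _ _) _)
  obtain ⟨a, ha⟩ := hdvd
  refine ⟨(a, c.toNat), by omega, ?_⟩
  rw [show ((c.toNat : ℕ) : ℤ) = c from Int.toNat_of_nonneg hc0]
  linear_combination -ha

/-- **Uniqueness of the predecessor**: `ad − bc = 1 = a'd − bc'` with `0 ≤ c, c' < d` force `(a, c) = (a', c')`.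
[folklore] -/
theorem pred_unique {b : ℤ} {d : ℕ} {a a' : ℤ} {c c' : ℕ} (hc : c < d) (hc' : c' < d)
    (h : a * d - b * c = 1) (h' : a' * d - b * c' = 1) : a = a' ∧ c = c' := by
  have hd0 : (0 : ℤ) < d := by exact_mod_cast (by omega : 0 < d)
  have hcop : IsCoprime (d : ℤ) b := ⟨a, -(c : ℤ), by linear_combination h⟩
  have hdvd : (d : ℤ) ∣ b * ((c : ℤ) - c') := ⟨a - a', by linear_combination h' - h⟩
  have hdvd' : (d : ℤ) ∣ (c : ℤ) - c' := hcop.dvd_of_dvd_mul_left hdvd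
  have habs : |(c : ℤ) - c'| < d := by rw [abs_lt]; constructor <;> omega
  have hcc : (c : ℤ) - c' = 0 := Int.eq_zero_of_abs_lt_dvd hdvd' habs
  have hcc' : c = c' := by omega
  subst hcc'
  refine ⟨?_, rfl⟩
  have : (a - a') * d = 0 := by linear_combination h - h'
  rcases mul_eq_zero.mp this with h0 | h0
  · linarith
  · exfalso; exact hd0.ne' h0

/-- **The canonical predecessor** `(a, c)` of `b/d`. [folklore] -/
def predPair (b : ℤ) (d : ℕ) (hd : 1 ≤ d) (h : IsCoprime b (d : ℤ)) : ℤ × ℕ := (exists_pred b hd h).choose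

/-- `c < d`. [folklore] -/
theorem predPair_lt (b : ℤ) (d : ℕ) (hd : 1 ≤ d) (h : IsCoprime b (d : ℤ)) : (predPair b d hd h).2 < d :=
  (exists_pred b hd h).choose_spec.1

/-- `ad − bc = 1`. [folklore] -/
theorem predPair_det (b : ℤ) (d : ℕ) (hd : 1 ≤ d) (h : IsCoprime b (d : ℤ)) :
    (predPair b d hd h).1 * d - b * (predPair b d hd h).2 = 1 :=
  (exists_pred b hd h).choose_spec.2

/-- The canonical predecessor is any predecessor with `0 ≤ c < d`. [folklore] -/
theorem predPair_eq {b : ℤ} {d : ℕ} (hd : 1 ≤ d) (h : IsCoprime b (d : ℤ)) {a : ℤ} {c : ℕ} (hc : c < d)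
    (hdet : a * d - b * c = 1) : predPair b d hd h = (a, c) := by
  obtain ⟨h1, h2⟩ := pred_unique (predPair_lt b d hd h) hc (predPair_det b d hd h) hdet
  exact Prod.ext h1 h2

/-- A proof-free constructor of `SL₂(ℤ)` elements (junk `1` off the determinant-one locus). [folklore] -/
def toSL (M : Matrix (Fin 2) (Fin 2) ℤ) : SL(2, ℤ) := by
  classical
  exact if h : M.det = 1 then ⟨M, h⟩ else 1

/-- `toSL (mat2 a b c d) = sl2 a b c d` on the determinant-one locus. [folklore] -/
theorem toSL_mat2 {a b c d : ℤ} (h : a * d - b * c = 1) : toSL (mat2 a b c d) = sl2 a b c d h := by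
  have hdet : (mat2 a b c d).det = 1 := by rw [det_mat2, h]
  unfold toSL
  rw [dif_pos hdet]
  rfl

/-- **The potential on reduced fractions**: `FF d b = F(b/d)` for `b` coprime to `d ≥ 1` (junk otherwise),
`FF 0 _ = F(∞) = 0`, defined by `F(b/d) = F(a/c) + f(a b; c d)` along the canonical predecessor —
well-founded recursion on the denominator. [cite: Manin1972, Thm. 1.9] -/
def FF (f : SL(2, ℤ) → V) : (d : ℕ) → ℤ → V
  | 0 => fun _ => 0
  | d + 1 => fun b =>
    if h : IsCoprime b ((d + 1 : ℕ) : ℤ) then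
      FF f (predPair b (d + 1) d.succ_pos h).2 (predPair b (d + 1) d.succ_pos h).1 +
        f (toSL (mat2 (predPair b (d + 1) d.succ_pos h).1 b (predPair b (d + 1) d.succ_pos h).2 (d + 1 : ℕ)))
    else 0
  termination_by d => d
  decreasing_by exact predPair_lt b (d + 1) d.succ_pos h

/-- `FF 0 = 0`. [folklore] -/
theorem FF_zero (f : SL(2, ℤ) → V) (b : ℤ) : FF f 0 b = 0 := by rw [FF]

/-- **The recursion**: `F(b/d) = F(a/c) + f(a b; c d)` for `ad − bc = 1`, `0 ≤ c < d`. [cite: Manin1972, Thm. 1.9] -/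
theorem FF_step (f : SL(2, ℤ) → V) {a b : ℤ} {c d : ℕ} (hcd : c < d) (hdet : a * d - b * c = 1) :
    FF f d b = FF f c a + f (sl2 a b c d hdet) := by
  obtain ⟨d', rfl⟩ : ∃ d', d = d' + 1 := ⟨d - 1, by omega⟩
  have hcop : IsCoprime b ((d' + 1 : ℕ) : ℤ) := ⟨-(c : ℤ), a, by linear_combination hdet⟩
  rw [FF]
  dsimp only
  rw [dif_pos hcop, predPair_eq d'.succ_pos hcop hcd hdet, toSL_mat2 hdet]

/-- `ofRat` is injective. [folklore] -/
theorem ofRat_injective : Function.Injective ofRat := by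
  intro r r' h
  rw [ofRat, ofRat, Projectivization.mk_eq_mk_iff'] at h
  obtain ⟨t, ht⟩ := h
  have h1 := congr_fun ht 1
  have h0 := congr_fun ht 0
  simp at h1 h0
  rw [h1, one_mul] at h0
  exact h0.symm

/-- `ofRat r ≠ ∞`. [folklore] -/
theorem ofRat_ne_infty (r : ℚ) : ofRat r ≠ infty := by
  intro h
  rw [ofRat, infty, Projectivization.mk_eq_mk_iff'] at h
  obtain ⟨t, ht⟩ := h
  have h1 := congr_fun ht 1
  simp at h1

/-- **The potential `F : ℙ¹(ℚ) → V`**, `F(∞) = 0`, `F(r) = FF (den r) (num r)`. [cite: Manin1972, Thm. 1.9] -/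
def Fpot (f : SL(2, ℤ) → V) (x : P1Q) : V := by
  classical
  exact if hx : ∃ r : ℚ, x = ofRat r then FF f hx.choose.den hx.choose.num else 0

/-- `F(∞) = 0`. [folklore] -/
theorem Fpot_infty (f : SL(2, ℤ) → V) : Fpot f infty = 0 := by
  have h : ¬ ∃ r : ℚ, infty = ofRat r := fun ⟨r, hr⟩ => ofRat_ne_infty r hr.symm
  unfold Fpot
  rw [dif_neg h]

/-- `F(r) = FF (den r) (num r)`. [folklore] -/
theorem Fpot_ofRat (f : SL(2, ℤ) → V) (r : ℚ) : Fpot f (ofRat r) = FF f r.den r.num := by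
  have h : ∃ r' : ℚ, ofRat r = ofRat r' := ⟨r, rfl⟩
  have hr : h.choose = r := (ofRat_injective h.choose_spec).symm
  unfold Fpot
  rw [dif_pos h, hr]

/-- `F([a : c]) = FF c a` for `a` coprime to `c ≥ 1`. [folklore] -/
theorem Fpot_cuspOf (f : SL(2, ℤ) → V) (a : ℤ) {c : ℕ} (hc : 1 ≤ c) (hcop : IsCoprime a (c : ℤ)) :
    Fpot f (cuspOf a c) = FF f c a := by
  have hc0 : (c : ℤ) ≠ 0 := by exact_mod_cast (by omega : c ≠ 0)
  have hc0' : (0 : ℤ) < c := by exact_mod_cast (by omega : 0 < c)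
  have hgcd : Nat.Coprime a.natAbs (c : ℤ).natAbs := Int.isCoprime_iff_gcd_eq_one.mp hcop
  have hnum : ((a : ℚ) / ((c : ℤ) : ℚ)).num = a := Rat.num_div_eq_of_coprime hc0' hgcd
  have hden : ((a : ℚ) / ((c : ℤ) : ℚ)).den = c := by exact_mod_cast Rat.den_div_eq_of_coprime hc0' hgcd
  rw [cuspOf_of_ne_zero _ hc0, Fpot_ofRat, hnum, hden]

/-- **The recursion on `ℙ¹(ℚ)`**: `F([b : d]) = F([a : c]) + f(a b; c d)` for `ad − bc = 1`, `0 ≤ c < d`.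
[cite: Manin1972, Thm. 1.9] -/
theorem Fpot_step (f : SL(2, ℤ) → V) {a b : ℤ} {c d : ℕ} (hcd : c < d) (hdet : a * d - b * c = 1) :
    Fpot f (cuspOf b d) = Fpot f (cuspOf a c) + f (sl2 a b c d hdet) := by
  have hcopb : IsCoprime b (d : ℤ) := ⟨-(c : ℤ), a, by linear_combination hdet⟩
  rw [Fpot_cuspOf f b (by omega) hcopb, FF_step f hcd hdet]
  congr 1
  rcases Nat.eq_zero_or_pos c with rfl | hc
  · rw [Nat.cast_zero, cuspOf_zero, Fpot_infty, FF_zero]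
  · have hcopa : IsCoprime a (c : ℤ) := ⟨(d : ℤ), -b, by linear_combination hdet⟩
    rw [Fpot_cuspOf f a hc hcopa]

end Potential

/-! ### `F(g·0) − F(g·∞) = f(g)` for all `g`: the induction -/

section Main

open P1Q

variable {V : Type*} [AddCommGroup V] {f : SL(2, ℤ) → V}

/-- The statement `P(g)`: `F([b : d]) − F([a : c]) = f(g)` for `g = (a b; c d)`. [folklore] -/
def Pst (f : SL(2, ℤ) → V) (g : SL(2, ℤ)) : Prop :=
  Fpot f (cuspOf (g 0 1) (g 1 1)) - Fpot f (cuspOf (g 0 0) (g 1 0)) = f g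

/-- Entries of `−g`. [folklore] -/
theorem neg_entries (g : SL(2, ℤ)) (i j : Fin 2) : (-g : SL(2, ℤ)) i j = -(g i j) := by
  rw [Matrix.SpecialLinearGroup.coe_neg]; rfl

/-- (R2) twice: `f(−g) = f(g)`. [folklore] -/
theorem IsManinFn.neg (hf : IsManinFn f) (g : SL(2, ℤ)) : f (-g) = f g := by
  have h1 := hf.1 (g * σM)
  rwa [mul_assoc, σM_mul_σM, mul_neg_one, hf.1 g, neg_neg] at h1

/-- (M1) `P(−g) ↔ P(g)`. [folklore] -/
theorem Pst_neg_iff (hf : IsManinFn f) (g : SL(2, ℤ)) : Pst f (-g) ↔ Pst f g := by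
  simp only [Pst, neg_entries, cuspOf_neg, hf.neg]

/-- (M2) `P(gσ) ↔ P(g)`. [folklore] -/
theorem Pst_σ_iff (hf : IsManinFn f) (g : SL(2, ℤ)) : Pst f (g * σM) ↔ Pst f g := by
  obtain ⟨e00, e01, e10, e11⟩ := mul_σM_entries g
  rw [Pst, Pst, e00, e01, e10, e11, cuspOf_neg, hf.1 g, ← neg_sub, neg_inj]

/-- (M3) the triangle: `P(gT) ∧ P(gL) ⇒ P(g)`. [folklore] -/
theorem Pst_of_TM_LM (hf : IsManinFn f) (g : SL(2, ℤ)) (hT : Pst f (g * TM)) (hL : Pst f (g * LM)) : Pst f g := by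
  obtain ⟨t00, t01, t10, t11⟩ := mul_TM_entries g
  obtain ⟨l00, l01, l10, l11⟩ := mul_LM_entries g
  rw [Pst, t00, t01, t10, t11] at hT
  rw [Pst, l00, l01, l10, l11] at hL
  rw [Pst, hf.2 g, ← hT, ← hL]
  abel

/-- (M3') `P(g) ∧ P(gL) ⇒ P(gT)`. [folklore] -/
theorem Pst_TM_of (hf : IsManinFn f) (g : SL(2, ℤ)) (hg : Pst f g) (hL : Pst f (g * LM)) : Pst f (g * TM) := by
  obtain ⟨t00, t01, t10, t11⟩ := mul_TM_entries g
  obtain ⟨l00, l01, l10, l11⟩ := mul_LM_entries g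
  rw [Pst, l00, l01, l10, l11] at hL
  rw [Pst] at hg
  rw [Pst, t00, t01, t10, t11, eq_sub_of_add_eq (hf.2 g).symm, ← hg, ← hL]
  abel

/-- Base case `c = 0`, `a = d = 1`: `g = (1 b; 0 1)`. [folklore] -/
theorem Pst_of_c_zero_one (g : SL(2, ℤ)) (hc : g 1 0 = 0) (h00 : g 0 0 = 1) (h11 : g 1 1 = 1) : Pst f g := by
  have step := Fpot_step f (a := 1) (b := g 0 1) (c := 0) (d := 1) zero_lt_one (by push_cast; ring)
  have hg : sl2 1 (g 0 1) ((0 : ℕ) : ℤ) ((1 : ℕ) : ℤ) (by push_cast; ring) = g :=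
    Subtype.ext (Matrix.ext fun i j => by fin_cases i <;> fin_cases j <;> simp [mat2, h00, h11, hc])
  rw [hg] at step
  rw [Pst, hc, h00, h11]
  have e1 : cuspOf (g 0 1) 1 = cuspOf (g 0 1) ((1 : ℕ) : ℤ) := by push_cast; rfl
  have e0 : cuspOf (1 : ℤ) 0 = cuspOf 1 ((0 : ℕ) : ℤ) := by push_cast; rfl
  rw [e1, e0, step, Nat.cast_zero, cuspOf_zero, Fpot_infty, zero_add, sub_zero]

/-- Base case `c = 0`. [folklore] -/
theorem Pst_of_c_zero (hf : IsManinFn f) (g : SL(2, ℤ)) (hc : g 1 0 = 0) : Pst f g := by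
  have hdet := ModularForms.det_entries g
  rw [hc, mul_zero, sub_zero] at hdet
  rcases Int.eq_one_or_neg_one_of_mul_eq_one' hdet with ⟨h00, h11⟩ | ⟨h00, h11⟩
  · exact Pst_of_c_zero_one g hc h00 h11
  · rw [← Pst_neg_iff hf]
    exact Pst_of_c_zero_one (-g) (by rw [neg_entries, hc, neg_zero]) (by rw [neg_entries, h00, neg_neg])
      (by rw [neg_entries, h11, neg_neg])

/-- Base case `d = 0`. [folklore] -/
theorem Pst_of_d_zero (hf : IsManinFn f) (g : SL(2, ℤ)) (hd : g 1 1 = 0) : Pst f g :=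
  (Pst_σ_iff hf g).mp (Pst_of_c_zero hf _ (by rw [(mul_σM_entries g).2.2.1, hd]))

/-- **The canonical edges**: `P(g)` for `0 ≤ c < d` is the recursion defining `F`. [folklore] -/
theorem Pst_canon (g : SL(2, ℤ)) (h0 : 0 ≤ g 1 0) (hlt : g 1 0 < g 1 1) : Pst f g := by
  set c := (g 1 0).toNat with hcdef
  set d := (g 1 1).toNat with hddef
  have hc : (c : ℤ) = g 1 0 := Int.toNat_of_nonneg h0
  have hd : (d : ℤ) = g 1 1 := Int.toNat_of_nonneg (by omega)
  have hcd : c < d := by omega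
  have hdet : g 0 0 * d - g 0 1 * c = 1 := by rw [hd, hc]; linear_combination ModularForms.det_entries g
  have step := Fpot_step f hcd hdet
  have hg : sl2 (g 0 0) (g 0 1) c d hdet = g :=
    Subtype.ext (Matrix.ext fun i j => by fin_cases i <;> fin_cases j <;> simp [mat2, hc, hd])
  rw [hg] at step
  rw [Pst, ← hc, ← hd, step, add_sub_cancel_left]

/-- **`F(g·0) − F(g·∞) = f(g)` for every `g ∈ SL₂(ℤ)`** (strong induction on `|c| + |d|`).
[cite: Manin1972, Thm. 1.9] -/
theorem Pst_all (hf : IsManinFn f) (g : SL(2, ℤ)) : Pst f g := by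
  suffices H : ∀ n : ℕ, ∀ g : SL(2, ℤ), (g 1 0).natAbs + (g 1 1).natAbs = n → Pst f g from H _ g rfl
  intro n
  induction n using Nat.strong_induction_on with
  | _ n ih =>
    -- the case `d > 0`
    have pos : ∀ g : SL(2, ℤ), (g 1 0).natAbs + (g 1 1).natAbs = n → 0 < g 1 1 → Pst f g := by
      intro g hn hd
      rcases lt_trichotomy (g 1 0) 0 with hc | hc | hc
      · -- `c < 0`
        rcases lt_trichotomy (g 1 0 + g 1 1) 0 with hs | hs | hs
        · -- `c + d < 0`: the edge of `gσ` is canonical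
          refine (Pst_σ_iff hf g).mp (Pst_canon _ ?_ ?_)
          · rw [(mul_σM_entries g).2.2.1]; exact hd.le
          · rw [(mul_σM_entries g).2.2.1, (mul_σM_entries g).2.2.2]; omega
        · -- `c = −d` (so `d = 1`): triangle with two base edges
          have hT : Pst f (g * TM) := Pst_of_d_zero hf _ (by rw [(mul_TM_entries g).2.2.2]; exact hs)
          have hL : Pst f (g * LM) := Pst_of_c_zero hf _ (by rw [(mul_LM_entries g).2.2.1]; exact hs)
          exact Pst_of_TM_LM hf g hT hL
        · -- `−d < c < 0`: `gL` canonical, `gT` smaller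
          have hL : Pst f (g * LM) := Pst_canon _ (by rw [(mul_LM_entries g).2.2.1]; omega)
            (by rw [(mul_LM_entries g).2.2.1, (mul_LM_entries g).2.2.2]; omega)
          have hT : Pst f (g * TM) := ih _ (by rw [← hn, (mul_TM_entries g).2.2.1, (mul_TM_entries g).2.2.2]; omega) _ rfl
          exact Pst_of_TM_LM hf g hT hL
      · exact Pst_of_c_zero hf g hc
      · -- `c > 0`
        rcases lt_or_ge (g 1 0) (g 1 1) with hcd | hcd
        · exact Pst_canon g hc.le hcd
        · -- `0 < d ≤ c`: pass to `h = −gσ`, whose `hL` is canonical and `hT` smaller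
          set h := -(g * σM) with hh
          obtain ⟨e1, e2, e3, e4⟩ := mul_σM_entries g
          have h10 : h 1 0 = -(g 1 1) := by rw [hh, neg_entries, e3]
          have h11 : h 1 1 = g 1 0 := by rw [hh, neg_entries, e4, neg_neg]
          have hL : Pst f (h * LM) := Pst_canon _ (by rw [(mul_LM_entries h).2.2.1, h10, h11]; omega)
            (by rw [(mul_LM_entries h).2.2.1, (mul_LM_entries h).2.2.2, h10, h11]; omega)
          have hT : Pst f (h * TM) :=
            ih _ (by rw [← hn, (mul_TM_entries h).2.2.1, (mul_TM_entries h).2.2.2, h10, h11]; omega) _ rfl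
          have hP : Pst f h := Pst_of_TM_LM hf h hT hL
          rwa [hh, Pst_neg_iff hf, Pst_σ_iff hf] at hP
    intro g hn
    rcases lt_trichotomy (g 1 1) 0 with hd | hd | hd
    · rw [← Pst_neg_iff hf]
      exact pos (-g) (by rw [neg_entries, neg_entries, Int.natAbs_neg, Int.natAbs_neg]; exact hn) (by rw [neg_entries]; omega)
    · exact Pst_of_d_zero hf g hd
    · exact pos g hn hd

end Main

/-! ### Manin's theorem -/

section Manin

open P1Q

variable {R V : Type*} [CommRing R] [AddCommGroup V] [Module R V] {f : SL(2, ℤ) → V}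

/-- **Manin's theorem (sufficiency of the relations)**: every `f : SL₂(ℤ) → V` satisfying (R2), (R3)
is `g ↦ φ(g·∞, g·0)` for an additive `φ`. [cite: Manin1972, Thm. 1.9] -/
theorem exists_modSym_of_isManinFn (hf : IsManinFn f) : ∃ φ ∈ modSym R V, maninFn φ = f := by
  refine ⟨fun x y => Fpot f y - Fpot f x, (mem_modSym_iff (R := R)).mpr fun x y z => by abel, funext fun g => ?_⟩
  rw [maninFn_apply, act_sl_infty, act_sl_zero]
  exact Pst_all hf g

variable (R) in
/-- **Manin's theorem**: `φ ↦ (g ↦ φ(g·∞, g·0))` is a bijection from additive functions of pairs of cusps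
(`Hom(Δ₀, V)`) onto the functions on `SL₂(ℤ)` satisfying the Manin relations. [cite: Manin1972, Thm. 1.9] -/
theorem existsUnique_modSym_of_isManinFn (hf : IsManinFn f) : ∃! φ : P1Q → P1Q → V, φ ∈ modSym R V ∧ maninFn φ = f := by
  obtain ⟨φ, hφ, hφf⟩ := exists_modSym_of_isManinFn (R := R) hf
  refine ⟨φ, ⟨hφ, hφf⟩, fun ψ ⟨hψ, hψf⟩ => modSym_eq_of_forall_unimodular hψ hφ fun g => ?_⟩
  exact (congr_fun hψf g).trans (congr_fun hφf g).symm

/-- A function comes from an additive `φ` iff it satisfies the Manin relations. [cite: Manin1972, Thm. 1.9] -/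
theorem isManinFn_iff : IsManinFn f ↔ ∃ φ ∈ modSym R V, maninFn φ = f :=
  ⟨exists_modSym_of_isManinFn, fun ⟨_, hφ, hφf⟩ => hφf ▸ isManinFn_maninFn hφ⟩

variable {S : Set (Matrix (Fin 2) (Fin 2) ℤ)} (A : CoeffActionOn S R V)

/-- The function of `φ | γ` is `g ↦ ρ(γ) f_φ(γ g)`. [folklore] -/
theorem maninFn_slash (γ g : SL(2, ℤ)) (φ : P1Q → P1Q → V) :
    maninFn (A.slash (γ : Matrix (Fin 2) (Fin 2) ℤ) φ) g = A.ρ (γ : Matrix (Fin 2) (Fin 2) ℤ) (maninFn φ (γ * g)) := by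
  rw [maninFn_apply, maninFn_apply, CoeffActionOn.slash_apply, act_act (det_coe_sl_ne_zero _) (det_coe_sl_ne_zero _),
    act_act (det_coe_sl_ne_zero _) (det_coe_sl_ne_zero _), Matrix.SpecialLinearGroup.coe_mul]

/-- **Equivariant Manin's theorem**: an `f` satisfying the Manin relations and `ρ(γ) f(γg) = f(g)` for
`γ ∈ Γ` is the function of a unique `Γ`-invariant symbol `φ ∈ Symb_Γ(V)` — the Manin-symbol
description of `Symb_Γ(V)`. [cite: Manin1972, Thm. 1.9] -/
theorem exists_Symb_of_isManinFn {Γ : Subgroup SL(2, ℤ)} (hf : IsManinFn f)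
    (hequiv : ∀ γ : SL(2, ℤ), γ ∈ Γ → ∀ g : SL(2, ℤ), A.ρ (γ : Matrix (Fin 2) (Fin 2) ℤ) (f (γ * g)) = f g) :
    ∃ φ ∈ A.Symb Γ, maninFn φ = f := by
  obtain ⟨φ, hφ, hφf⟩ := exists_modSym_of_isManinFn (R := R) hf
  refine ⟨φ, ⟨hφ, fun γ hγ => ?_⟩, hφf⟩
  refine modSym_eq_of_forall_unimodular (A.slash_mem_modSym _ hφ) hφ fun g => ?_
  change maninFn (A.slash (γ : Matrix (Fin 2) (Fin 2) ℤ) φ) g = maninFn φ g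
  rw [maninFn_slash, hφf, hequiv γ hγ g]

end Manin

end Literature.NumberTheory.EllipticCurves

end
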